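import Summits.ResolutionOfSingularities.ResolutionOfSingularities.Theorems.FrobeniusLadderFInjectiveMacaulayficationProp44SliceCurvePlumbing
import Summits.ResolutionOfSingularities.ResolutionOfSingularities.Theorems.FrobeniusLadderFInjectiveMacaulayficationProp44InvariantsDim
import Summits.ResolutionOfSingularities.ResolutionOfSingularities.Theorems.FrobeniusLadderFInjectiveMacaulayficationProp44SliceDimTwoCodim
import Literature.AlgebraicGeometry.Resolution.OrderSemicontinuity
import Literature.AlgebraicGeometry.Resolution.ExceptionalPointsFinite
import Literature.AlgebraicGeometry.Resolution.GermsOfClosedSubsets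
import HarnessLib

/-!
# [CoP1] Prop. 4.4 (`CossartPiltant2008_prop44`, F-71): a TIDY stage — order-`μ` curves regular and pairwise disjoint — decomposes into the
# PIECES the patching assembly consumes (structure (*) of p. 10); `stub_reach` reduces to «reach a tidy stage»

[L1 W4.5a · crux `FInjectiveMacaulayfication` (stmt-ResolutionOfSingularities-15315); D-0154 (2) RES inputs cell, seat res-inputs-p-8b (gen 2,
«assembly»). PROVED, fact-free, definition-free; nothing of the manuscript under adjudication is used. AI-written; AI review is weaker than
expert review.]

THE POINT. The patching skeleton (`plan/inputs/candidates/F71_ASSEMBLY_W46_SKELETON_p8b.lean`, composition PROVED) asks its REACH input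
`stub_reach` for a stage whose order-`≥ μ` locus `Σ` is covered by finitely many pairwise disjoint closed PIECES of four kinds (closed threefold
point with `τ ≥ 2` / with `τ = 1`, closed point of coheight `2`, regular irreducible equimultiple curve cut out by pairs of regular parameters).
This file proves that the piece decomposition is AUTOMATIC at any stage satisfying the two-line condition TIDY — «every order-`μ` point `ζ` of
coheight `2` which is not a closed point (= the generic point of a one-dimensional component of `Σ`) has `V(𝓘_{cl ζ})` regular, and two such
closures are disjoint or equal» ([CoP1] p. 10: "4- If all connected components of `Σ(i)` are regular …"; structure (*) "`Σ(i)` is a disjoint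
union of closed points and projective lines"): the pieces are the closures of the maximal points of `Σ` (finitely many on the Noetherian stage,
tree `maxPoints_finite`; they cover, tree `exists_mem_maxPoints_specializes`); a maximal point of coheight `3` is a closed point
(`isClosed_singleton_of_coheight_eq_three`) of embedding dimension `3` with `τ ≥ 1` (kinds 1/2); one of coheight `2` is a closed point (kind 3)
or the generic point of a curve all of whose points have order `μ` (upper semicontinuity) and are cut out by pairs of regular parameters
(`exists_rsopPair_of_mem_curve`, p619773) — kind 4. Hence `stub_reach` FOLLOWS from the cleaner statement «a W4.6 sequence reaches a TIDY
stage» (`stub_reach_of_reachTidy`, oracle `hreach`), which is what Cossart–Piltant's steps 1–3 (census T2a′ + T2c + T2b′ + T3) deliver.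

## What is proved (no definitions, no named facts)
* `isClosed_singleton_of_coheight_eq_three`, `coheight_eq_two_of_not_isClosed` — bookkeeping of the maximal points of `Σ` on a Noetherian scheme of dimension `≤ 3`;
* `exists_pieces_of_tidy` — TIDY stage ⇒ the piece decomposition (conclusion of `stub_reach` at the stage itself);
* `stub_reach_of_reachTidy` — `stub_reach` (skeleton v3 binders verbatim) from the oracle «reach a tidy stage».

`CossartPiltant2008_prop44` is NOT proved; resolution in dimension `≥ 4` / positive characteristic is NOT proved.

References: V. Cossart, O. Piltant, J. Algebra 320 (2008), Prop. 4.4 (proof, p. 10, step 4 and (*)) [CossartPiltant2008]; The Stacks Project,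
Tags 0BA8, 01J7, 02IZ [StacksProject].
-/

-- `Summit.<Summit>.<Sub>.Theorems` with `Sub = Summit` (single-conjunct summit, D-0017)
set_option linter.dupNamespace false

noncomputable section

open CategoryTheory CategoryTheory.Limits AlgebraicGeometry TopologicalSpace IsLocalRing
open Literature.AlgebraicGeometry.Resolution Scheme.IdealSheafData

namespace Summit.ResolutionOfSingularities.ResolutionOfSingularities.Theorems

namespace CP2008Prop44

universe u

/-! ## §0 Points of a Noetherian scheme of dimension `≤ 3` -/

/-- On a scheme all of whose points have codimension `≤ 3`, **a point of codimension `3` is a closed point**. [cite: StacksProject, Tag 02IZ] -/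
theorem isClosed_singleton_of_coheight_eq_three {X : Scheme.{u}} (hcoh3 : ∀ z : X, Order.coheight z ≤ 3) {y : X}
    (hy : Order.coheight y = 3) : IsClosed ({y} : Set X) := by
  rw [← closure_subset_iff_isClosed]
  intro z hz
  have hyz : y ⤳ z := specializes_iff_mem_closure.mpr hz
  by_contra hzy
  have hzy' : ¬ z ⤳ y := fun h => hzy ((Specializes.antisymm h hyz).eq)
  have hlt : z < y := lt_of_le_not_ge (Scheme.le_iff_specializes.mpr hyz) fun h' => hzy' (Scheme.le_iff_specializes.mp h')
  have h1 : Order.coheight y + 1 ≤ Order.coheight z := Order.coheight_add_one_le hlt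
  rw [hy] at h1
  exact absurd (h1.trans (hcoh3 z)) (by decide)

/-- On a scheme all of whose points have codimension `≤ 3`, **a non-closed point of codimension `> 1` has codimension `2`**.
[cite: StacksProject, Tag 02IZ] -/
theorem coheight_eq_two_of_not_isClosed {X : Scheme.{u}} (hcoh3 : ∀ z : X, Order.coheight z ≤ 3) {ζ : X}
    (h1 : 1 < Order.coheight ζ) (hζ : ¬ IsClosed ({ζ} : Set X)) : Order.coheight ζ = 2 := by
  have h3 := hcoh3 ζ
  have hne3 : Order.coheight ζ ≠ 3 := fun h => hζ (isClosed_singleton_of_coheight_eq_three hcoh3 h)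
  generalize hc : Order.coheight ζ = c at h1 h3 hne3
  induction c using ENat.recTopCoe with
  | top => exact absurd h3 (by simp)
  | coe n =>
    have h1' : 1 < n := by exact_mod_cast h1
    have h3' : n ≤ 3 := by exact_mod_cast h3
    have hne3' : n ≠ 3 := fun h => hne3 (by rw [h]; rfl)
    have : n = 2 := by omega
    rw [this]; rfl

/-! ## §1 A tidy stage decomposes into pieces -/

/-- **TIDY ⇒ PIECES.** `X` integral Noetherian regular quasi-excellent of dimension `≤ 3`; `J`, `μ ≥ 1`, `ord ≤ μ` everywhere, `V(J)` of codimension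
`≥ 2`. TIDY: every point `ζ` of order `μ` and codimension `2` which is not a closed point has `V(𝓘_{cl ζ})` regular, and the closures of two
distinct such points are disjoint. Then the order-`≥ μ` locus is covered by finitely many pairwise disjoint closed pieces of the four kinds of the
patching skeleton (conclusion of `stub_reach` at the stage itself). The pieces are the closures of the maximal points of `Σ = {ord ≥ μ}` (closed by
upper semicontinuity on the quasi-excellent `X`, finitely many maximal points on the Noetherian `X`).
[cite: CossartPiltant2008, Prop. 4.4 (proof, p. 10, step 4, (*))] [cite: StacksProject, Tag 0BA8] -/
theorem exists_pieces_of_tidy {X : Scheme.{u}} [IsIntegral X] [IsNoetherian X] (hX : Scheme.IsRegular X)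
    (hqe : Scheme.IsQuasiExcellent X) (hX3 : topologicalKrullDim X ≤ 3) (J : X.IdealSheafData) {μ : ℕ} (hμ : 1 ≤ μ)
    (hle : ∀ z, idealOrder J z ≤ μ) (hcodim : ∀ z ∈ J.support, 1 < Order.coheight z)
    (htidy_reg : ∀ ζ : X, (μ : ℕ∞) ≤ idealOrder J ζ → Order.coheight ζ = 2 → ¬ IsClosed ({ζ} : Set X) →
      Scheme.IsRegular (vanishingIdeal (⟨closure {ζ}, isClosed_closure⟩ : Closeds X)).subscheme)
    (htidy_disj : ∀ ζ₁ ζ₂ : X, (μ : ℕ∞) ≤ idealOrder J ζ₁ → Order.coheight ζ₁ = 2 → ¬ IsClosed ({ζ₁} : Set X) →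
      (μ : ℕ∞) ≤ idealOrder J ζ₂ → Order.coheight ζ₂ = 2 → ¬ IsClosed ({ζ₂} : Set X) → ζ₁ ≠ ζ₂ →
      Disjoint (closure ({ζ₁} : Set X)) (closure {ζ₂})) :
    ∃ (n : ℕ) (Z : Fin n → Set X),
      (∀ i, IsClosed (Z i)) ∧ (∀ i j, i ≠ j → Disjoint (Z i) (Z j)) ∧
      (∀ z : X, (μ : ℕ∞) ≤ idealOrder J z → ∃ i, z ∈ Z i) ∧
      ∀ i, (∃ x : X, Z i = {x} ∧ idealOrder J x = μ ∧ (maximalIdeal (X.presheaf.stalk x)).spanFinrank = 3 ∧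
              ∀ hr : IsRegularLocalRing (X.presheaf.stalk x), 2 ≤ @stalkTau X J x hr μ) ∨
           (∃ x : X, Z i = {x} ∧ idealOrder J x = μ ∧ (maximalIdeal (X.presheaf.stalk x)).spanFinrank = 3 ∧
              ∀ hr : IsRegularLocalRing (X.presheaf.stalk x), @stalkTau X J x hr μ = 1) ∨
           (∃ x : X, Z i = {x} ∧ idealOrder J x = μ ∧ Order.coheight x = 2) ∨
           (∃ Y : Closeds X, Z i = (Y : Set X) ∧ Scheme.IsRegular (vanishingIdeal Y).subscheme ∧
              IsIrreducible (Y : Set X) ∧ (∀ y ∈ (Y : Set X), idealOrder J y = μ) ∧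
              ∀ y ∈ (Y : Set X), ∀ hr : IsRegularLocalRing (X.presheaf.stalk y),
                ∃ c : Fin 2 → X.presheaf.stalk y, @IsRsopPart _ _ _ 2 c ∧
                  Ideal.span (Set.range c) = stalkIdeal (vanishingIdeal Y) y) := by
  classical
  have hcoh3 : ∀ z : X, Order.coheight z ≤ 3 := (topologicalKrullDim_le_iff_forall_coheight_le X 3).mp hX3
  -- `Σ = {ord ≥ μ}` is closed; its maximal points are finitely many
  set Sg : Set X := {z : X | (μ : ℕ∞) ≤ idealOrder J z} with hSgdef
  have hJne : J ≠ ⊥ := ne_bot_of_forall_one_lt_coheight hcodim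
  have hSgcl : IsClosed Sg := isClosed_setOf_le_idealOrder_of_isJ2 hX (fun U => (hqe U).isJ2Ring) hJne μ
  have hord : ∀ z ∈ Sg, idealOrder J z = μ := fun z hz => le_antisymm (hle z) hz
  have hsupp : ∀ z ∈ Sg, z ∈ J.support := fun z hz => by
    rw [← one_le_idealOrder_iff, hord z hz]; exact_mod_cast hμ
  have hfin : (maxPoints Sg).Finite := maxPoints_finite hSgcl
  obtain ⟨n, f, hf⟩ := hfin.fin_embedding
  have hfP : ∀ i, f i ∈ maxPoints Sg := fun i => hf ▸ Set.mem_range_self i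
  have hfS : ∀ i, f i ∈ Sg := fun i => maxPoints_subset Sg (hfP i)
  -- a maximal point is a closed point of codimension `3`, or has codimension `2`
  have hkind0 : ∀ i, (Order.coheight (f i) = 3 ∧ IsClosed ({f i} : Set X)) ∨ Order.coheight (f i) = 2 := by
    intro i
    by_cases hcl : IsClosed ({f i} : Set X)
    · have h1 : (1 : ℕ∞) < Order.coheight (f i) := hcodim _ (hsupp _ (hfS i))
      have h3 := hcoh3 (f i)
      generalize hc : Order.coheight (f i) = c at h1 h3
      induction c using ENat.recTopCoe with
      | top => exact absurd h3 (by simp)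
      | coe k =>
        have h1' : 1 < k := by exact_mod_cast h1
        have h3' : k ≤ 3 := by exact_mod_cast h3
        rcases (by omega : k = 2 ∨ k = 3) with rfl | rfl
        · exact Or.inr rfl
        · exact Or.inl ⟨rfl, hcl⟩
    · exact Or.inr (coheight_eq_two_of_not_isClosed hcoh3 (hcodim _ (hsupp _ (hfS i))) hcl)
  refine ⟨n, fun i => closure {f i}, fun i => isClosed_closure, fun i j hij => ?_, fun z hz => ?_, fun i => ?_⟩
  · -- disjointness
    have hne : f i ≠ f j := fun h => hij (f.injective h)
    -- a closed maximal point meets no other closure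
    have key : ∀ a b : Fin n, f a ≠ f b → IsClosed ({f a} : Set X) → Disjoint (closure ({f a} : Set X)) (closure {f b}) := by
      intro a b hab hcl
      rw [hcl.closure_eq, Set.disjoint_singleton_left]
      intro hmem
      have hsp : f b ⤳ f a := specializes_iff_mem_closure.mpr hmem
      exact hab ((mem_maxPoints_iff.mp (hfP a)).2 (f b) (hfS b) hsp).symm
    by_cases hci : IsClosed ({f i} : Set X)
    · exact key i j hne hci
    by_cases hcj : IsClosed ({f j} : Set X)
    · exact (key j i hne.symm hcj).symm
    have hi2 : Order.coheight (f i) = 2 := by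
      rcases hkind0 i with ⟨-, h⟩ | h
      · exact absurd h hci
      · exact h
    have hj2 : Order.coheight (f j) = 2 := by
      rcases hkind0 j with ⟨-, h⟩ | h
      · exact absurd h hcj
      · exact h
    exact htidy_disj (f i) (f j) (hfS i) hi2 hci (hfS j) hj2 hcj hne
  · -- cover
    obtain ⟨η, hη, hηz⟩ := exists_mem_maxPoints_specializes hSgcl hz
    rw [← hf] at hη
    obtain ⟨i, rfl⟩ := hη
    exact ⟨i, specializes_iff_mem_closure.mp hηz⟩
  · -- the kind of the piece `cl {f i}`
    haveI : IsRegularLocalRing (X.presheaf.stalk (f i)) := hX (f i)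
    rcases hkind0 i with ⟨h3, hcl⟩ | h2
    · -- a closed threefold point: `τ ≥ 2` or `τ = 1`
      have hd : (maximalIdeal (X.presheaf.stalk (f i))).spanFinrank = 3 := spanFinrank_maximalIdeal_stalk_eq (f i) h3
      have h1 : 1 ≤ stalkTau J (f i) μ := one_le_stalkTau J (f i) hμ (hord _ (hfS i))
      by_cases hτ : stalkTau J (f i) μ = 1
      · exact Or.inr (Or.inl ⟨f i, hcl.closure_eq, hord _ (hfS i), hd, fun hr => hτ⟩)
      · exact Or.inl ⟨f i, hcl.closure_eq, hord _ (hfS i), hd, fun hr => by omega⟩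
    · by_cases hcl : IsClosed ({f i} : Set X)
      · -- a closed point of codimension `2`
        exact Or.inr (Or.inr (Or.inl ⟨f i, hcl.closure_eq, hord _ (hfS i), h2⟩))
      · -- a regular curve
        refine Or.inr (Or.inr (Or.inr ⟨⟨closure {f i}, isClosed_closure⟩, rfl, htidy_reg (f i) (hfS i) h2 hcl,
          isIrreducible_singleton.closure, fun y hy => ?_, fun y hy hr => ?_⟩))
        · haveI := hX y
          have hsp : f i ⤳ y := specializes_iff_mem_closure.mpr hy
          exact le_antisymm (hle y) ((hfS i).trans (idealOrder_le_of_specializes hsp J))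
        · exact exists_rsopPair_of_mem_curve hX hcoh3 (htidy_reg (f i) (hfS i) h2 hcl) rfl h2 hy

/-! ## §2 `stub_reach` from «reach a tidy stage» -/

/-- **`stub_reach` DERIVED from the oracle «a W4.6 sequence of permissible blowing-ups reaches a TIDY stage»** (binders of the skeleton's
`stub_reach`, v3, VERBATIM, followed by the oracle `hreach`; the invariants at the stage — integral, Noetherian, regular, quasi-excellent, `ord ≤ μ`,
codimension `≥ 2`, dimension `≤ 3` — come from `IsPermissibleBlowupSeq.prop44Invariants` (p615828) and `IsPermissibleBlowupSeq.topologicalKrullDim_le`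
(p618778)). [cite: CossartPiltant2008, Prop. 4.4 (proof, pp. 9–10, steps 1–4, (*))] -/
theorem stub_reach_of_reachTidy {X : Scheme.{u}} [IsIntegral X] [IsNoetherian X] (hX : Scheme.IsRegular X)
    (hqe : Scheme.IsQuasiExcellent X) (hX3 : topologicalKrullDim X ≤ 3) (J : X.IdealSheafData) {μ : ℕ} (hμ : 1 ≤ μ)
    (hle : ∀ z, idealOrder J z ≤ μ) (hcodim : ∀ z ∈ J.support, 1 < Order.coheight z)
    (hreach : ∃ (X₁ : Scheme.{u}) (Φ : X₁ ⟶ X) (J₁ : X₁.IdealSheafData) (_ : CampaignW46.IsPermissibleBlowupSeq J μ Φ J₁),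
      (∀ ζ : X₁, (μ : ℕ∞) ≤ idealOrder J₁ ζ → Order.coheight ζ = 2 → ¬ IsClosed ({ζ} : Set X₁) →
          Scheme.IsRegular (vanishingIdeal (⟨closure {ζ}, isClosed_closure⟩ : Closeds X₁)).subscheme) ∧
      (∀ ζ₁ ζ₂ : X₁, (μ : ℕ∞) ≤ idealOrder J₁ ζ₁ → Order.coheight ζ₁ = 2 → ¬ IsClosed ({ζ₁} : Set X₁) →
          (μ : ℕ∞) ≤ idealOrder J₁ ζ₂ → Order.coheight ζ₂ = 2 → ¬ IsClosed ({ζ₂} : Set X₁) → ζ₁ ≠ ζ₂ →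
          Disjoint (closure ({ζ₁} : Set X₁)) (closure {ζ₂}))) :
    ∃ (X₁ : Scheme.{u}) (Φ : X₁ ⟶ X) (J₁ : X₁.IdealSheafData) (_ : CampaignW46.IsPermissibleBlowupSeq J μ Φ J₁)
      (n : ℕ) (Z : Fin n → Set X₁),
      (∀ i, IsClosed (Z i)) ∧ (∀ i j, i ≠ j → Disjoint (Z i) (Z j)) ∧
      (∀ z : X₁, (μ : ℕ∞) ≤ idealOrder J₁ z → ∃ i, z ∈ Z i) ∧
      ∀ i, (∃ x : X₁, Z i = {x} ∧ idealOrder J₁ x = μ ∧ (maximalIdeal (X₁.presheaf.stalk x)).spanFinrank = 3 ∧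
              ∀ hr : IsRegularLocalRing (X₁.presheaf.stalk x), 2 ≤ @stalkTau X₁ J₁ x hr μ) ∨
           (∃ x : X₁, Z i = {x} ∧ idealOrder J₁ x = μ ∧ (maximalIdeal (X₁.presheaf.stalk x)).spanFinrank = 3 ∧
              ∀ hr : IsRegularLocalRing (X₁.presheaf.stalk x), @stalkTau X₁ J₁ x hr μ = 1) ∨
           (∃ x : X₁, Z i = {x} ∧ idealOrder J₁ x = μ ∧ Order.coheight x = 2) ∨
           (∃ Y : Closeds X₁, Z i = (Y : Set X₁) ∧ Scheme.IsRegular (vanishingIdeal Y).subscheme ∧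
              IsIrreducible (Y : Set X₁) ∧ (∀ y ∈ (Y : Set X₁), idealOrder J₁ y = μ) ∧
              ∀ y ∈ (Y : Set X₁), ∀ hr : IsRegularLocalRing (X₁.presheaf.stalk y),
                ∃ c : Fin 2 → X₁.presheaf.stalk y, @IsRsopPart _ _ _ 2 c ∧
                  Ideal.span (Set.range c) = stalkIdeal (vanishingIdeal Y) y) := by
  obtain ⟨X₁, Φ, J₁, hseq, hreg₁, hdisj₁⟩ := hreach
  obtain ⟨hint₁, hnoeth₁, hX₁, hqe₁, hle₁, hcodim₁⟩ := IsPermissibleBlowupSeq.prop44Invariants hX hqe hμ hle hcodim hseq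
  haveI := hint₁
  haveI := hnoeth₁
  have hX3₁ : topologicalKrullDim X₁ ≤ 3 := hseq.topologicalKrullDim_le inferInstance hX3
  obtain ⟨n, Z, h1, h2, h3, h4⟩ := exists_pieces_of_tidy hX₁ hqe₁ hX3₁ J₁ hμ hle₁ hcodim₁ hreg₁ hdisj₁
  exact ⟨X₁, Φ, J₁, hseq, n, Z, h1, h2, h3, h4⟩

end CP2008Prop44

end Summit.ResolutionOfSingularities.ResolutionOfSingularities.Theorems

end
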